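import Summits.QuantumFields.YangMills.Theorems.AllWindowsColdBoxBulkMidSandwichLocalisedScore
import Summits.QuantumFields.YangMills.Theorems.SandwichVariancePinchingCeilingSmooth

/-!
# The quadratic variance CEILING, LOCALISED to the core (whitened frame, smooth potential)
# (crux idea `logconcave-core-extension` on ⟨stmt-QuantumFields-24006⟩ — the card's IDEA-NEEDED leaf
# «localised QCC on a convex body at the intrinsic `r_K`», ceiling half)

`ceilingWhitened_localised`: for `0 ≤ δ_K ≤ δ ≤ ½`, `H` symmetric, `b`, `A ∈ C²(ℝⁿ)` with the GLOBAL
second-difference sandwich `(1 ± δ)|h|²`, the centring `∫x_i e^{−A} = 0`, and on a measurable core `K` the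
Hessian pinching `(1 − δ_K)|v|² ≤ D²A(x)(v,v) ≤ (1 + δ_K)|v|²`:

  `gE(q²) − gE(q)² ≤ (1 + 168·ρ)·(2 tr H² + |b|²)`,  `ρ := δ_K + δ·(μ_A(Kᶜ))^{1/4}`,

`μ_A(Kᶜ) = ∫_{Kᶜ}e^{−A}/∫e^{−A}` — i.e. the tree's `ceilingWhitened_of_contDiff` (constant `26·δ`) with the
GLOBAL sandwich constant replaced by the CORE constant up to the fourth root of the off-core Gibbs mass.
Constants are dimension-free.  PROOF: the Stein proxy of the tree's ceiling (`q − Eq = G − (R − ER)`,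
`(g − r)² ≤ (1+t)g² + (1+t⁻¹)r²`) with the localised inputs `score_sq_le_localised`,
`integral_mulVec_sq_le_localised`, `setIntegral_affine_normSq_le`, `remainder_variance_le_localised`, the
bookkeeping `score_algebra_localised` / `remainder_algebra_localised` / `ceiling_algebra_localised`
(optimal `t` by AM–GM, no case split at `ρ = 0`).

HONEST SCOPE.  Free-hands work of the LEAD seat of ⟨stmt-QuantumFields-24006⟩ (FCL lineage) on an ingredient
of an UN-TRIAGED crux idea card; classical log-concave probability.  No stub of LINE-18, no crux, rung or
summit is proved; the Yang–Mills mass gap is NOT proved by any of this.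
-/

noncomputable section

namespace Summit.QuantumFields.YangMills.Theorems.SandwichVariancePinching

open MeasureTheory Real Filter Topology Set
open Summit.QuantumFields.YangMills.Cruxes.TransportCovarianceTransfer (contDiff_quadObs trace_mul_self_of_isSymm)

variable {n : ℕ}

/-- The fourth root `s = (P/Z)^{1/4}` of a ratio `0 ≤ P ≤ Z`, `0 < Z`: `0 ≤ s ≤ 1`, `s⁴·Z = P`, `√(P·Z) = Z·s²`.
[folklore] -/
theorem fourthRoot_ratio_facts {P Z : ℝ} (hP : 0 ≤ P) (hPZ : P ≤ Z) (hZ : 0 < Z) :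
    0 ≤ Real.sqrt (Real.sqrt (P / Z)) ∧ Real.sqrt (Real.sqrt (P / Z)) ≤ 1 ∧
      Real.sqrt (Real.sqrt (P / Z)) ^ 4 * Z = P ∧
      Real.sqrt (P * Z) = Z * Real.sqrt (Real.sqrt (P / Z)) ^ 2 := by
  have hr0 : 0 ≤ P / Z := div_nonneg hP hZ.le
  have hr1 : P / Z ≤ 1 := (div_le_one hZ).mpr hPZ
  have hs2 : Real.sqrt (Real.sqrt (P / Z)) ^ 2 = Real.sqrt (P / Z) := Real.sq_sqrt (Real.sqrt_nonneg _)
  refine ⟨Real.sqrt_nonneg _, ?_, ?_, ?_⟩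
  · rw [Real.sqrt_le_one]; exact Real.sqrt_le_one.mpr hr1 |>.trans (le_refl 1)
  · have : Real.sqrt (Real.sqrt (P / Z)) ^ 4 = (Real.sqrt (Real.sqrt (P / Z)) ^ 2) ^ 2 := by ring
    rw [this, hs2, Real.sq_sqrt hr0]
    field_simp
  · rw [hs2]
    have e : P * Z = (P / Z) * Z ^ 2 := by field_simp
    rw [e, Real.sqrt_mul hr0, Real.sqrt_sq hZ.le]
    ring

/-- **THE LOCALISED VARIANCE CEILING FOR A SMOOTH POTENTIAL IN THE WHITENED FRAME.**
For `0 ≤ δ_K ≤ δ ≤ ½`, `H` symmetric, `b ∈ ℝⁿ`, `A ∈ C²(ℝⁿ)` with the global second-difference sandwich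
`(1 ± δ)|h|²`, the centring `∫x_i e^{−A} = 0`, and the core Hessian pinching `(1 ± δ_K)|v|²` on a measurable
`K`: `gE(q²) − gE(q)² ≤ (1 + 168(δ_K + δ·(∫_{Kᶜ}e^{−A}/∫e^{−A})^{1/4}))·(2 tr H² + |b|²)`. [folklore] -/
theorem ceilingWhitened_localised {δ : ℝ} (hδ : 0 ≤ δ) (hδ2 : δ ≤ 1 / 2)
    (H : Matrix (Fin n) (Fin n) ℝ) (b : Fin n → ℝ) {A : (Fin n → ℝ) → ℝ} (hH : H.IsSymm)
    (hA : ContDiff ℝ 2 A)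
    (hsw : ∀ x h : Fin n → ℝ, (1 - δ) * (h ⬝ᵥ h) ≤ A (x + h) + A (x - h) - 2 * A x ∧
      A (x + h) + A (x - h) - 2 * A x ≤ (1 + δ) * (h ⬝ᵥ h))
    (hcent : ∀ i : Fin n, ∫ x, x i * exp (-A x) = 0)
    {K : Set (Fin n → ℝ)} (hK : MeasurableSet K) {δK : ℝ} (hδK : 0 ≤ δK) (hδKδ : δK ≤ δ)
    (hloc : ∀ x ∈ K, ∀ v : Fin n → ℝ, (1 - δK) * (v ⬝ᵥ v) ≤ fderiv ℝ (fderiv ℝ A) x v v ∧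
      fderiv ℝ (fderiv ℝ A) x v v ≤ (1 + δK) * (v ⬝ᵥ v)) :
    (∫ x, (x ⬝ᵥ H.mulVec x + b ⬝ᵥ x) * (x ⬝ᵥ H.mulVec x + b ⬝ᵥ x) * exp (-A x)) / (∫ x, exp (-A x)) -
        (∫ x, (x ⬝ᵥ H.mulVec x + b ⬝ᵥ x) * exp (-A x)) / (∫ x, exp (-A x)) *
          ((∫ x, (x ⬝ᵥ H.mulVec x + b ⬝ᵥ x) * exp (-A x)) / (∫ x, exp (-A x))) ≤
      (1 + 168 * (δK + δ * Real.sqrt (Real.sqrt ((∫ x in Kᶜ, exp (-A x)) / ∫ x, exp (-A x))))) *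
        (2 * (H * H).trace + b ⬝ᵥ b) := by
  have hδ1 : δ < 1 := by linarith
  have hδK1 : δK < 1 := lt_of_le_of_lt hδKδ hδ1
  have hAc : Continuous A := hA.continuous
  obtain ⟨C₀, κ, _, hκ, hlb⟩ := exists_quadratic_lower_of_sandwich hAc hδ1 hsw
  have hZint : Integrable fun x => exp (-A x) := by
    have := integrable_mul_exp_neg_of_growth hAc continuous_const hκ (by norm_num : 0 ≤ 8) hlb
      (w := fun _ => (1:ℝ)) (D := 1) (fun x => by simp)
    simpa using this
  have hZ : 0 < ∫ x, exp (-A x) := integral_exp_pos hZint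
  set Z : ℝ := ∫ x, exp (-A x) with hZdef
  set P : ℝ := ∫ x in Kᶜ, exp (-A x) with hPdef
  have hP0 : 0 ≤ P := setIntegral_nonneg hK.compl fun x _ => (exp_pos _).le
  have hPZ : P ≤ Z := setIntegral_le_integral hZint (ae_of_all _ fun x => (exp_pos _).le)
  obtain ⟨hs0, hs1, hs4, hsPZ⟩ := fourthRoot_ratio_facts hP0 hPZ hZ
  set s : ℝ := Real.sqrt (Real.sqrt (P / Z)) with hsdef
  set q : (Fin n → ℝ) → ℝ := fun x => x ⬝ᵥ H.mulVec x + b ⬝ᵥ x with hqdef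
  have hqc1 : ContDiff ℝ 1 q := contDiff_quadObs H b
  have hqc : Continuous q := hqc1.continuous
  obtain ⟨Dq, Dq', hDq0, _, hqb, _⟩ := quadObs_growth hH b
  set τ : ℝ := (H * H).trace with hτdef
  have hτ0 : 0 ≤ τ := by rw [hτdef, trace_mul_self_of_isSymm hH]; positivity
  have hτrows : (∑ i, H i ⬝ᵥ H i) = τ := by
    rw [hτdef, trace_mul_self_of_isSymm hH]; simp [dotProduct, sq]
  have hbb : 0 ≤ b ⬝ᵥ b := by simpa using dotProduct_self_star_nonneg b
  set S2 : ℝ := ∫ x, (H.mulVec x ⬝ᵥ H.mulVec x) * exp (-A x) with hS2def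
  set Xoff : ℝ := ∫ x in Kᶜ, ((H.mulVec x + b) ⬝ᵥ (H.mulVec x + b)) * exp (-A x) with hXoffdef
  have hXoff0 : 0 ≤ Xoff := setIntegral_nonneg hK.compl fun x _ =>
    mul_nonneg (by simpa using dotProduct_self_star_nonneg (H.mulVec x + b)) (exp_pos _).le
  -- the localised inputs
  have hS2le : S2 ≤ τ * ((1 - δK)⁻¹ * (Z - s ^ 4 * Z) + (1 - δ)⁻¹ * (s ^ 4 * Z)) := by
    have h := integral_mulVec_sq_le_localised hA hδ1 hsw hcent hK hδK1 (fun x hx v => (hloc x hx v).1) hH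
    rw [← hZdef, ← hPdef, ← hs4] at h
    have e : (Z - s ^ 4 * Z) = Z - s ^ 4 * Z := rfl
    simpa only [hτdef] using h
  have hXoffle : Xoff ≤ 14 * (τ / (1 - δ) + b ⬝ᵥ b) * (Z * s ^ 2) := by
    have h := setIntegral_affine_normSq_le hA hδ1 hsw hcent H b hK.compl
    rw [← hZdef, ← hPdef, hτrows, hsPZ] at h
    exact h
  have hIuu := integral_affine_normSq_eq hA hδ1 hsw hcent hH b
  have hX : ∫ x, (fderiv ℝ A x (H.mulVec x + b) - H.trace) ^ 2 * exp (-A x) ≤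
      τ * Z + (1 + δK) * (S2 + (b ⬝ᵥ b) * Z) + (δ - δK) * Xoff :=
    score_sq_le_localised hA hδ hδ1 hsw hcent hK (fun x hx v => (hloc x hx v).2) hH b
  have hG := score_algebra_localised hτ0 hbb hZ.le hδ hδ2 hδK hδKδ hs0 hs1 hXoff0 hS2le hXoffle hX
  set R : (Fin n → ℝ) → ℝ := fun x => fderiv ℝ A x (H.mulVec x + b) - q x with hRdef
  have hVR := remainder_variance_le_localised hA hδ hδ1 hsw hcent hK hδK hδKδ hloc hH b
  rw [hIuu, ← hZdef, ← hPdef, ← hs4] at hVR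
  have hV := remainder_algebra_localised hτ0 hbb hZ.le hδ hδ2 hδK hδKδ hs0 hs1 hXoff0 hS2le hXoffle hVR
  -- growth / integrability
  have hRc : Continuous R := ((contDiff_fderiv_affine hA H b).sub hqc1).continuous
  obtain ⟨D₁, hD₁0, hD₁⟩ := exists_abs_fderiv_affine_le hA hδ hsw H b
  have hRb : ∀ x, |R x| ≤ (D₁ + Dq) * (1 + ‖x‖) ^ 3 := fun x => by
    calc |R x| ≤ |fderiv ℝ A x (H.mulVec x + b)| + |q x| := abs_sub _ _
      _ ≤ D₁ * (1 + ‖x‖) ^ 3 + Dq * (1 + ‖x‖) ^ 3 := add_le_add (hD₁ x) (hqb x)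
      _ = (D₁ + Dq) * (1 + ‖x‖) ^ 3 := by ring
  have hIq : Integrable fun x => q x * exp (-A x) :=
    integrable_mul_exp_neg_of_growth hAc hqc hκ (by norm_num) hlb hqb
  have hIqq : Integrable fun x => q x * q x * exp (-A x) :=
    integrable_mul_exp_neg_of_growth hAc (hqc.mul hqc) hκ (by norm_num : 3 + 3 ≤ 8) hlb (abs_mul_le_growth hqb hqb)
  have hIRi : Integrable fun x => R x * exp (-A x) :=
    integrable_mul_exp_neg_of_growth hAc hRc hκ (by norm_num) hlb hRb
  have hIRRi : Integrable fun x => R x ^ 2 * exp (-A x) := by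
    have := abs_mul_le_growth hRb hRb
    refine integrable_mul_exp_neg_of_growth hAc (hRc.pow 2) hκ (by norm_num : 3 + 3 ≤ 8) hlb
      (D := (D₁ + Dq) * (D₁ + Dq)) (fun x => ?_)
    rw [sq]; exact this x
  have hIdA : Integrable fun x => fderiv ℝ A x (H.mulVec x + b) * exp (-A x) :=
    integrable_mul_exp_neg_of_growth hAc (contDiff_fderiv_affine hA H b).continuous hκ (by norm_num) hlb hD₁
  -- `∫ ∂_uA e^{−A} = trH · Z` (score identity with `F ≡ 1`)
  have hIdAval : ∫ x, fderiv ℝ A x (H.mulVec x + b) * exp (-A x) = H.trace * Z := by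
    have h1 := integral_mul_fderiv_affine_mul_exp_neg hA hδ hδ1 hsw H b
      (F := fun _ => (1:ℝ)) contDiff_const (DF := 1) (DF' := 0)
      (fun x => by rw [abs_one, one_mul]; exact one_le_pow₀ (by linarith [norm_nonneg x]))
      (fun x j => by simp)
    simp only [one_mul, fderiv_fun_const, Pi.zero_apply, zero_apply, zero_add, mul_one] at h1
    rw [h1, integral_const_mul]
  set Iq : ℝ := ∫ x, q x * exp (-A x) with hIqdef
  set Iqq : ℝ := ∫ x, q x * q x * exp (-A x) with hIqqdef
  set IR : ℝ := ∫ x, R x * exp (-A x) with hIRdef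
  set IRR : ℝ := ∫ x, R x ^ 2 * exp (-A x) with hIRRdef
  set IG2 : ℝ := ∫ x, (fderiv ℝ A x (H.mulVec x + b) - H.trace) ^ 2 * exp (-A x) with hIG2def
  have hmean : Iq = H.trace * Z - IR := by
    have e1 : (fun x => R x * exp (-A x)) = fun x => fderiv ℝ A x (H.mulVec x + b) * exp (-A x) - q x * exp (-A x) := by
      funext x; simp only [hRdef]; ring
    rw [hIRdef, e1, integral_sub hIdA hIq, hIdAval]
    ring
  have hVRi : ∫ x, (R x - IR / Z) ^ 2 * exp (-A x) = (IRR * Z - IR ^ 2) / Z := by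
    have e : (fun x => (R x - IR / Z) ^ 2 * exp (-A x)) = fun x =>
        R x ^ 2 * exp (-A x) - (2 * (IR / Z)) * (R x * exp (-A x)) + (IR / Z) ^ 2 * exp (-A x) := by
      funext x; ring
    have hI1 : Integrable fun x => R x ^ 2 * exp (-A x) - (2 * (IR / Z)) * (R x * exp (-A x)) :=
      hIRRi.sub (hIRi.const_mul _)
    rw [e, integral_add hI1 (hZint.const_mul _), integral_sub hIRRi (hIRi.const_mul _), integral_const_mul,
      integral_const_mul, ← hIRRdef, ← hIRdef, ← hZdef]
    field_simp; ring
  have hV0 : 0 ≤ (IRR * Z - IR ^ 2) / Z := by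
    rw [← hVRi]; exact integral_nonneg fun x => mul_nonneg (sq_nonneg _) (exp_pos _).le
  have hG0 : 0 ≤ IG2 := integral_nonneg fun x => mul_nonneg (sq_nonneg _) (exp_pos _).le
  -- the `t`-inequality (Stein proxy)
  have hsplit : ∀ t : ℝ, 0 < t →
      Iqq - Iq ^ 2 / Z ≤ (1 + t) * IG2 + (1 + t⁻¹) * ((IRR * Z - IR ^ 2) / Z) := by
    intro t ht
    have hVq : ∫ x, (q x - Iq / Z) ^ 2 * exp (-A x) = Iqq - Iq ^ 2 / Z := by
      have e : (fun x => (q x - Iq / Z) ^ 2 * exp (-A x)) = fun x =>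
          q x * q x * exp (-A x) - (2 * (Iq / Z)) * (q x * exp (-A x)) + (Iq / Z) ^ 2 * exp (-A x) := by
        funext x; ring
      have hI1 : Integrable fun x => q x * q x * exp (-A x) - (2 * (Iq / Z)) * (q x * exp (-A x)) :=
        hIqq.sub (hIq.const_mul _)
      rw [e, integral_add hI1 (hZint.const_mul _), integral_sub hIqq (hIq.const_mul _), integral_const_mul,
        integral_const_mul, ← hIqqdef, ← hIqdef, ← hZdef]
      field_simp; ring
    have hpt : ∀ x, (q x - Iq / Z) ^ 2 * exp (-A x) ≤
        (1 + t) * ((fderiv ℝ A x (H.mulVec x + b) - H.trace) ^ 2 * exp (-A x)) +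
          (1 + t⁻¹) * ((R x - IR / Z) ^ 2 * exp (-A x)) := by
      intro x
      have hid : q x - Iq / Z = (fderiv ℝ A x (H.mulVec x + b) - H.trace) - (R x - IR / Z) := by
        simp only [hRdef]
        rw [hmean]
        field_simp
        ring
      rw [hid]
      have he : 0 ≤ exp (-A x) := (exp_pos _).le
      have hs := mul_le_mul_of_nonneg_right (sq_sub_le_split ht (fderiv ℝ A x (H.mulVec x + b) - H.trace)
        (R x - IR / Z)) he
      nlinarith only [hs]
    have hGc : Continuous fun x => fderiv ℝ A x (H.mulVec x + b) - H.trace :=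
      (contDiff_fderiv_affine hA H b).continuous.sub continuous_const
    have hGb : ∀ x, |fderiv ℝ A x (H.mulVec x + b) - H.trace| ≤ (D₁ + |H.trace|) * (1 + ‖x‖) ^ 3 := fun x => by
      have h2 : (1:ℝ) ≤ (1 + ‖x‖) ^ 3 := one_le_pow₀ (by linarith [norm_nonneg x])
      calc |fderiv ℝ A x (H.mulVec x + b) - H.trace| ≤ |fderiv ℝ A x (H.mulVec x + b)| + |H.trace| := abs_sub _ _
        _ ≤ D₁ * (1 + ‖x‖) ^ 3 + |H.trace| * (1 + ‖x‖) ^ 3 :=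
            add_le_add (hD₁ x) (le_mul_of_one_le_right (abs_nonneg _) h2)
        _ = (D₁ + |H.trace|) * (1 + ‖x‖) ^ 3 := by ring
    have hI_G2 : Integrable fun x => (fderiv ℝ A x (H.mulVec x + b) - H.trace) ^ 2 * exp (-A x) := by
      have := abs_mul_le_growth hGb hGb
      refine integrable_mul_exp_neg_of_growth hAc (hGc.pow 2) hκ (by norm_num : 3 + 3 ≤ 8) hlb
        (D := (D₁ + |H.trace|) * (D₁ + |H.trace|)) (fun x => ?_)
      rw [sq]; exact this x
    have hgen : ∀ (F : (Fin n → ℝ) → ℝ) (DF c : ℝ), Continuous F → (∀ x, |F x| ≤ DF * (1 + ‖x‖) ^ 3) →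
        Integrable fun x => (F x - c) ^ 2 * exp (-A x) := by
      intro F DF c hFc hFb
      have hb' : ∀ x, |F x - c| ≤ (DF + |c|) * (1 + ‖x‖) ^ 3 := fun x => by
        have h2 : (1:ℝ) ≤ (1 + ‖x‖) ^ 3 := one_le_pow₀ (by linarith [norm_nonneg x])
        calc |F x - c| ≤ |F x| + |c| := abs_sub _ _
          _ ≤ DF * (1 + ‖x‖) ^ 3 + |c| * (1 + ‖x‖) ^ 3 :=
              add_le_add (hFb x) (le_mul_of_one_le_right (abs_nonneg _) h2)
          _ = (DF + |c|) * (1 + ‖x‖) ^ 3 := by ring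
      have := abs_mul_le_growth hb' hb'
      refine integrable_mul_exp_neg_of_growth hAc ((hFc.sub continuous_const).pow 2) hκ (by norm_num : 3 + 3 ≤ 8)
        hlb (D := (DF + |c|) * (DF + |c|)) (fun x => ?_)
      rw [sq]; exact this x
    have hIq_c := hgen q Dq (Iq / Z) hqc hqb
    have hIR_c := hgen R (D₁ + Dq) (IR / Z) hRc hRb
    have hsum : Integrable fun x => (1 + t) * ((fderiv ℝ A x (H.mulVec x + b) - H.trace) ^ 2 * exp (-A x)) +
        (1 + t⁻¹) * ((R x - IR / Z) ^ 2 * exp (-A x)) := (hI_G2.const_mul _).add (hIR_c.const_mul _)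
    have hmono := integral_mono hIq_c hsum hpt
    rw [integral_add (hI_G2.const_mul _) (hIR_c.const_mul _), integral_const_mul, integral_const_mul,
      hVq, hVRi, ← hIG2def] at hmono
    exact hmono
  -- the numbers
  set rV : ℝ := 2 * τ + b ⬝ᵥ b with hrVdef
  have hrV0 : 0 ≤ rV := by rw [hrVdef]; positivity
  set ρ : ℝ := δK + δ * s with hρdef
  have hρ0 : 0 ≤ ρ := by rw [hρdef]; positivity
  have hρ1 : ρ ≤ 1 := by rw [hρdef]; nlinarith only [hδKδ, hδ2, hs1, hδ, hs0]
  have hGle : IG2 ≤ (1 + 24 * ρ) * (rV * Z) := by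
    have := hG; rw [hρdef, hrVdef]; linarith
  have hVle : (IRR * Z - IR ^ 2) / Z ≤ 64 * ρ ^ 2 * (rV * Z) := by
    rw [div_le_iff₀ hZ, hρdef, hrVdef]
    have := hV
    nlinarith only [this]
  have hfinal := ceiling_algebra_localised (mul_nonneg hrV0 hZ.le) hρ0 hρ1 hG0 hV0 hGle hVle hsplit
  have hfrac : Iqq / Z - Iq / Z * (Iq / Z) = (Iqq - Iq ^ 2 / Z) / Z := by field_simp
  rw [hfrac, div_le_iff₀ hZ]
  calc Iqq - Iq ^ 2 / Z ≤ (1 + 168 * ρ) * (rV * Z) := hfinal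
    _ = (1 + 168 * ρ) * rV * Z := by ring

end Summit.QuantumFields.YangMills.Theorems.SandwichVariancePinching

end
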